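import Literature.IUT.HodgeTheaters.GlobalFrobenioidsCoricLawsToyKit
import Literature.IUT.HodgeTheaters.GlobalFrobenioidsCoricLawsToyData
import Literature.IUT.HodgeTheaters.GlobalFrobenioidsInfKappa
import HarnessLib

/-!
# [IUTchI] Example 5.1 (v), pp. 127–128: NON-VACUITY of the N-side Kummer-rigidity LAW BINDERS of the layer-5
# certificate row `IUTchI:Ex5.1(v)` at ONE datum with NON-ABELIAN `π₁^rat(†𝒟^⊛)` (proof-only witness)

S. Mochizuki, *Inter-universal Teichmüller theory I*, kurims manuscript (May 2020), §5 Example 5.1 (v), p. 127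
l. 13 – p. 128 l. 54 and p. 129 l. 5–24 ([IUTchI] Ex 5.1 (v) pp.127–129) [claim: Mochizuki2012, status: disputed]
(D-0012 claim key; nothing disputed is asserted; no side is taken on [IUTchIII] Cor. 3.12).

Cell abc-iut, sub-DAG `plan/L5/SUBDAG-IUTchI-Ex51.md` rows E51/L22–L31; layer-5 certificate
`Summits/ABC/IUTFork/Conditional/Layer5OfSEx51.lean` (v0.1, `layer5_held_ex51v`: 1 FACT + 21 LAW binders ⊢ 8
closed conjuncts) and `Layer5OfSV02.lean` (v0.2, `layer5_held_ex51v_v2`).  The N-SIDE binders of that row are the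
laws about the reconstruction output `N : NFBridgeRecon` ([AbsTopIII] Thm 1.9 merge) and its Kummer realisations:
F-2571 `MκIsInvariants`; (a)/(a×) Kummer naturality `h_Ex51v_nat(x)`; (b′)/(b′×) divisor transport `h_Ex51v_ord(x)`;
Rmk 3.1.7 (i)/(ii) `h_Ex51v_pole` / `zero` / `polex` / `zerox`; `h_Ex51v_moves` (E51/L23: some element of
`π₁^{rat/κ-sol}(†𝒟^⊛)` MOVES an ∞κ×-coric function); and, at v0.2, the E51/L31 torsion criterion
`h_Ex51v_tors_some` / `h_Ex51v_tors_every` over Kummer restriction data `R`.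

abc-iut-w5-d110 proved the TIGHTNESS datum `NFBridgeRecon.not_laws_of_commutative`
(`GlobalFrobenioidsCoricRigidityLawsCentral.lean`, p432142): (a×) + (b′×) + `zerox` + `moves` have NO model whose
`π₁^rat(†𝒟^⊛)` is commutative — "NV witnesses must be non-abelian".  **Here is one**:

* `NFBridgeRecon.CoricLawsToy.exists_laws_nonabelian` — ONE datum (`N`, container `H` with its `π₁^rat`- and
  `Ẑ^×`-actions, realisations `κ`, `κx`, points `X`, orders `ord`, restriction data `R`) at which `π₁^rat(†𝒟^⊛)` is
  NOT commutative and ALL the N-side binders of v0.1 AND v0.2 hold simultaneously (15 conjuncts, each stated in the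
  certificate's own shape, universes `0`);
* `NFBridgeRecon.CoricLawsToy.exists_ex51v_binders_v1` — the ELEVEN N-side binders of v0.1's `layer5_held_ex51v`
  (p431142) in its ORDER (hF_2571, nat, natx, ord, ordx, pole, zero, polex, zerox, moves);
* `NFBridgeRecon.CoricLawsToy.exists_ex51v_binders_v2` — the NINE N-side binders of v0.2's `layer5_held_ex51v_v2`
  (p433973) in its ORDER (nat, natx, ord, ordx, polex, zero, moves, tors_some, tors_every).
The C/Cf cyclotome-comparison blocks of the same theorems are independent data, witnessed at the tree's REAL `Ẑ^×` by
abc-iut's `CyclotomeComparison.exists_zhatModel_uniqueCyclotomeIso` / `CyclotomeComparisonFamily.exists_zhatModel_integral_laws`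
(`GlobalFrobenioidsCyclotomesZHatModel.lean`) — cited, not re-proved.

THE DATUM — HONEST LABEL: **DEGENERATE TOY** (`π₁^rat := S₃` discrete; genuine side = the tree's REAL `Ẑ` / `Ẑ^×`,
`ZHatLevel.eta`, `MulAut Ẑ`); joint SATISFIABILITY of the binder block, NOT a discharge and NOT a claim about the
genuine `Gal(L̄_C/L_C)`-datum of print.  `π₁^rat = π₁(†𝒟^⊛) := S₃ = Perm(Fin 3)`, `K_rat = 𝕄̄^⊛ := Frac ℚ[x₀,x₁,x₂]`
(variables permuted); `𝕄^⊛_κ = 𝕄^⊛_∞κ := {2ⁿ}` (fixed), `𝕄^⊛_∞κ× := {2ⁿ} ∪ {x₀, x₁, x₂}` (one orbit with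
self-normalising stabilisers, so BOTH model pairs have only the identity automorphism — kit lemma
`CoricLawsToy.iso_apply_eq_self` — and (a)/(a×) hold with `u := 1`, while the transposition `(0 1) ∈ π₁^{rat/κ-sol}`
MOVES `x₀`); `solKer := ⊤`; `H := Ẑ × ℤ³`, `κ(2ⁿ) = κx(2ⁿ) = (η n, 0)`, `κx(xᵢ) = (1, eᵢ)`; `X := Fin 2`,
`ord(2ⁿ) = n`, `ord = 0` elsewhere; `R` = one restriction map, the projection to `ℤ³`.  Ingredients:
`GlobalFrobenioidsCoricLawsToyKit.lean` (generic pair lemmas), `GlobalFrobenioidsCoricLawsToyData.lean` (the field and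
the container).  Nothing of abc-iut-w5-d110 / -w4-d056 / -L5-t1 / -L5-t12 is edited; their declarations are consumed
BY NAME.  Not a cone member; typed ≠ proved; PROOF-ONLY: no `def`, no `instance`, no `structure`, no new Prop fact.
-/

namespace Literature.IUT.HodgeTheaters

namespace NFBridgeRecon

namespace CoricLawsToy

open ProfiniteGrp ProfiniteGrp.ProfiniteCompletion
open Literature.AnabelianGeometry.EtaleTheta Literature.AnabelianGeometry.EtaleTheta.ZHatLevel

/-- **Joint witness, non-abelian `π₁^rat`.**  One datum at which `π₁^rat(†𝒟^⊛)` is not commutative and every N-side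
law binder of the layer-5 certificate row `IUTchI:Ex5.1(v)` (v0.1 `layer5_held_ex51v` and v0.2 `layer5_held_ex51v_v2`)
holds: F-2571; (a), (a×); (b′) in both printed phrasings (on `𝕄^⊛_κ`, and on the `π₁^rat`-fixed ∞κ-coric functions),
(b′×); pole/zero shapes; `moves`; and the E51/L31 torsion criterion ("some" and "every") for the restriction data `R`.
DEGENERATE TOY (see the module docstring); complement of `NFBridgeRecon.not_laws_of_commutative`.
([IUTchI] Ex 5.1 (v) pp.127–129) [claim: Mochizuki2012, status: disputed] -/
theorem exists_laws_nonabelian :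
    ∃ (N : NFBridgeRecon.{0}) (H : Type) (_ : CommGroup H) (_ : MulAction N.piRat H)
      (_ : MulAction (MulAut (completion (GrpCat.of (Multiplicative ℤ)))) H)
      (κ : N.infκPair.KummerRealization H) (κx : N.infκxPair.KummerRealization H)
      (X : Type) (ord : X → N.Krat → ℤ) (R : CriticalRestrictionData N.piRat H),
      (∃ a b : N.piRat, a * b ≠ b * a) ∧
      N.MκIsInvariants ∧
      (∀ e : CoricPair.Iso N.infκPair N.infκPair,
        ∃ u : MulAut (completion (GrpCat.of (Multiplicative ℤ))),
          ∀ y : N.infκPair.carrier, κ.toFun (e.toEquiv y) = u • κ.toFun y) ∧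
      (∀ e : CoricPair.Iso N.infκxPair N.infκxPair,
        ∃ u : MulAut (completion (GrpCat.of (Multiplicative ℤ))),
          ∀ y : N.infκxPair.carrier, κx.toFun (e.toEquiv y) = u • κx.toFun y) ∧
      (∀ (u : MulAut (completion (GrpCat.of (Multiplicative ℤ)))) (f f' : N.infκPair.carrier),
        (f : N.Krat) ∈ N.Mκ → (f' : N.Krat) ∈ N.Mκ → κ.toFun f' = u • κ.toFun f →
        ∀ x : X, u (eta (ord x f)) = eta (ord x f')) ∧
      (∀ (u : MulAut (completion (GrpCat.of (Multiplicative ℤ)))) (f f' : N.infκPair.carrier),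
        (∀ g : N.piRat, g • (f : N.Krat) = f) → (∀ g : N.piRat, g • (f' : N.Krat) = f') →
        κ.toFun f' = u • κ.toFun f → ∀ x : X, u (eta (ord x f)) = eta (ord x f')) ∧
      (∀ (u : MulAut (completion (GrpCat.of (Multiplicative ℤ)))) (f f' : N.infκxPair.carrier),
        (∀ g : N.piRat, g • (f : N.Krat) = f) → (∀ g : N.piRat, g • (f' : N.Krat) = f') →
        κx.toFun f' = u • κx.toFun f → ∀ x : X, u (eta (ord x f)) = eta (ord x f')) ∧
      (∀ f' ∈ N.Mκ, ∀ x₁ x₂ : X, x₁ ≠ x₂ → ¬ (ord x₁ f' < 0 ∧ ord x₂ f' < 0)) ∧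
      (∃ f ∈ N.Mκ, ∃ x₁ x₂ : X, x₁ ≠ x₂ ∧ 0 < ord x₁ f ∧ 0 < ord x₂ f) ∧
      (∃ f ∈ N.Minfκ, (∀ g : N.piRat, g • f = f) ∧ ∃ x₁ x₂ : X, x₁ ≠ x₂ ∧ 0 < ord x₁ f ∧ 0 < ord x₂ f) ∧
      (∀ f' ∈ N.Minfκx, (∀ g : N.piRat, g • f' = f') →
        ∀ x₁ x₂ : X, x₁ ≠ x₂ → ¬ (ord x₁ f' < 0 ∧ ord x₂ f' < 0)) ∧
      (∃ f ∈ N.Minfκx, (∀ g : N.piRat, g • f = f) ∧ ∃ x₁ x₂ : X, x₁ ≠ x₂ ∧ 0 < ord x₁ f ∧ 0 < ord x₂ f) ∧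
      (∃ g ∈ N.ratKsolKer, ∃ f ∈ N.Minfκx, g • f ≠ f) ∧
      (∀ f : N.infκxPair.carrier, (f : N.Krat) ∈ N.Minfκ ↔ ∃ i : R.Idx, IsOfFinOrder (R.res i (κx.toFun f))) ∧
      (∀ f : N.infκxPair.carrier, (f : N.Krat) ∈ N.Minfκ ↔ ∀ i : R.Idx, IsOfFinOrder (R.res i (κx.toFun f))) := by
  classical
  -- closed facts about `S₃ = Perm (Fin 3)`, decided before any local data is introduced
  have hS3 : Equiv.swap (0 : Fin 3) 1 * Equiv.swap 1 2 ≠ Equiv.swap 1 2 * Equiv.swap 0 1 := by decide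
  have hsw : (Equiv.swap (0 : Fin 3) 1) 0 ≠ 0 := by decide
  have hmv' : ∀ i : Fin 3, ∃ g : Equiv.Perm (Fin 3), g i ≠ i := by decide
  have hmove' : ∀ i j : Fin 3, i ≠ j → ∃ g : Equiv.Perm (Fin 3), g i = i ∧ g j ≠ j := by decide
  have h01 : (0 : Fin 2) ≠ 1 := by decide
  -- the toy data
  obtain ⟨K, instK, actK, c, x, hsc, hsx, hc_inj, hx_inj, hcx, hc0, hcc, hc_ne, hx_ne, hcxS, hxxS⟩ := exists_S3Field
  obtain ⟨H, instH, actH, twH, z, v, T, instT, r, hz_inj, hv_inj, hzv, hzz, hzvR, hvvR, hgz, hgv, transport,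
    htor_z, htor_v⟩ := exists_container
  letI : TopologicalSpace (Equiv.Perm (Fin 3)) := ⊥
  haveI : DiscreteTopology (Equiv.Perm (Fin 3)) := ⟨rfl⟩
  let G : ProfiniteGrp.{0} := ProfiniteGrp.of (Equiv.Perm (Fin 3))
  letI act : MulSemiringAction G K := MulSemiringAction.compHom K (MonoidHom.id (Equiv.Perm (Fin 3)))
  let ρ : G →* Equiv.Perm (Fin 3) := MonoidHom.id _
  let ρ₀ : G →* Equiv.Perm (Fin 0) := 1
  let x₀ : Fin 0 → K := fun i => i.elim0
  let v₀ : Fin 0 → H := fun i => i.elim0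
  have hsc' : ∀ (g : G) (n : ℕ), g • c n = c n := fun g n => hsc g n
  have hsx' : ∀ (g : G) (i : Fin 3), g • x i = x (ρ g i) := fun g i => hsx g i
  have hmv : ∀ i : Fin 3, ∃ g : G, ρ g i ≠ i := fun i =>
    let ⟨g, hg⟩ := hmv' i
    ⟨g, hg⟩
  have hmove : ∀ i j : Fin 3, i ≠ j → ∃ g : G, ρ g i = i ∧ ρ g j ≠ j := fun i j hij =>
    let ⟨g, hg⟩ := hmove' i j hij
    ⟨g, hg⟩
  have hM₁ : ∀ f : K, f ∈ Set.range c ↔ (∃ n, f = c n) ∨ ∃ i : Fin 0, f = x₀ i :=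
    fun f => ⟨fun ⟨n, hn⟩ => Or.inl ⟨n, hn.symm⟩, fun h => h.elim (fun ⟨n, hn⟩ => ⟨n, hn.symm⟩) fun ⟨i, _⟩ => i.elim0⟩
  have hM₂ : ∀ f : K, f ∈ Set.range c ∪ Set.range x ↔ (∃ n, f = c n) ∨ ∃ i, f = x i :=
    fun f => ⟨fun h => h.elim (fun ⟨n, hn⟩ => Or.inl ⟨n, hn.symm⟩) fun ⟨i, hi⟩ => Or.inr ⟨i, hi.symm⟩,
      fun h => h.elim (fun ⟨n, hn⟩ => Or.inl ⟨n, hn.symm⟩) fun ⟨i, hi⟩ => Or.inr ⟨i, hi.symm⟩⟩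
  -- the interface datum
  let N : NFBridgeRecon.{0} :=
    { l := 5
      piDast := G
      piDcirc := ⊤
      Fbar := K
      fbarField := instK
      fbarAction := act
      isOpen_stabilizer_fbar := fun _ => isOpen_discrete _
      piRat := G
      ratToAst := ContinuousMonoidHom.id G
      ratToAst_surjective := Function.surjective_id
      Krat := K
      kratField := instK
      kratAction := act
      isOpen_stabilizer_krat := fun _ => isOpen_discrete _
      const := RingHom.id K
      const_smul := fun _ _ => rfl
      Mκ := Set.range c
      Minfκ := Set.range c
      Minfκx := Set.range c ∪ Set.range x
      mκ_subset := subset_rfl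
      minfκ_subset := Set.subset_union_left
      zero_notMem := by
        rintro (⟨n, hn⟩ | ⟨i, hi⟩)
        · exact hc_ne n hn
        · exact hx_ne i hi
      smul_mem_minfκ := by
        rintro g f ⟨n, rfl⟩
        exact ⟨n, (hsc' g n).symm⟩
      smul_mem_minfκx := by
        rintro g f (⟨n, rfl⟩ | ⟨i, rfl⟩)
        · exact Or.inl ⟨n, (hsc' g n).symm⟩
        · exact Or.inr ⟨ρ g i, (hsx' g i).symm⟩
      solKer := ⊤
      solKer_normal := inferInstance
      AutD := PUnit
      autGroup := inferInstance
      Autε := ⊤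
      AutSL := ⊤
      AutSLε := ⊤
      autSLε_le := le_rfl
      autSLε_le_autε := le_rfl
      lift := fun _ => ContinuousMulEquiv.refl G }
  letI actN : MulAction N.piRat H := MulAction.compHom H (MonoidHom.id (Equiv.Perm (Fin 3)))
  have hgz' : ∀ (g : N.piRat) (n : ℕ), g • z n = z n := fun g n => hgz g n
  have hgv' : ∀ (g : N.piRat) (i : Fin 3), g • v i = v (ρ g i) := fun g i => hgv g i
  -- the Kummer realisations (kit)
  obtain ⟨κ, hκc, -⟩ := exists_kummerRealization (N := N) (S := N.Minfκ)
    (fun g _ hf => N.smul_mem_minfκ g hf) c x₀ ρ₀ hM₁ hc_inj (fun i => i.elim0) (fun _ i => i.elim0) hc0 hcc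
    (fun _ i => i.elim0) (fun i => i.elim0) hsc' (fun _ i => i.elim0) z v₀ hz_inj (fun i => i.elim0)
    (fun _ i => i.elim0) hzz (fun _ i => i.elim0) (fun i => i.elim0) hgz' (fun _ i => i.elim0)
  obtain ⟨κx, hκxc, hκxx⟩ := exists_kummerRealization (N := N) (S := N.Minfκx)
    (fun g _ hf => N.smul_mem_minfκx g hf) c x ρ hM₂ hc_inj hx_inj hcx hc0 hcc hcxS hxxS hsc' hsx' z v hz_inj hv_inj
    hzv hzz hzvR hvvR hgz' hgv'
  -- the order map: `ord (2ⁿ) = n`, `0` elsewhere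
  let ordK : K → ℤ := fun f => if h : ∃ n, f = c n then (h.choose : ℤ) else 0
  have ord_c : ∀ n, ordK (c n) = n := by
    intro n
    have hh : ∃ m, c n = c m := ⟨n, rfl⟩
    have h1 : ordK (c n) = (hh.choose : ℤ) := dif_pos hh
    rw [h1, ← hc_inj hh.choose_spec]
  have ord_nonneg : ∀ f, 0 ≤ ordK f := by
    intro f
    by_cases hh : ∃ m, f = c m
    · have h1 : ordK f = (hh.choose : ℤ) := dif_pos hh
      rw [h1]; exact Int.natCast_nonneg _
    · have h1 : ordK f = 0 := dif_neg hh
      rw [h1]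
  have two_zeros : 0 < ordK (c 1) := by rw [ord_c]; exact one_pos
  -- the restriction data: one subgroup, restriction = `r`
  let R : CriticalRestrictionData N.piRat H :=
    { Idx := PUnit, subgroup := fun _ => ⊤, target := fun _ => T, grp := fun _ => instT, res := fun _ => r }
  -- the divisor-transport law on the ray, both pairs
  have ord_ray : ∀ (u : MulAut (completion (GrpCat.of (Multiplicative ℤ)))) (n m : ℕ), z m = u • z n →
      ∀ X : Fin 2, u (eta (ordK (c n))) = eta (ordK (c m)) := by
    intro u n m h _
    rw [ord_c, ord_c]
    exact transport u n m h
  have law_ord : ∀ (u : MulAut (completion (GrpCat.of (Multiplicative ℤ)))) (f f' : N.infκPair.carrier),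
      κ.toFun f' = u • κ.toFun f → ∀ X : Fin 2, u (eta (ordK f)) = eta (ordK f') := by
    intro u f f' hκ X
    obtain ⟨n, hn⟩ := f.2
    obtain ⟨m, hm⟩ := f'.2
    have ef : f = ⟨c n, ⟨n, rfl⟩⟩ := Subtype.ext hn.symm
    have ef' : f' = ⟨c m, ⟨m, rfl⟩⟩ := Subtype.ext hm.symm
    subst ef ef'
    rw [hκc, hκc] at hκ
    exact ord_ray u n m hκ X
  have law_ordx : ∀ (u : MulAut (completion (GrpCat.of (Multiplicative ℤ)))) (f f' : N.infκxPair.carrier),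
      (∀ g : N.piRat, g • (f : N.Krat) = f) → (∀ g : N.piRat, g • (f' : N.Krat) = f') →
      κx.toFun f' = u • κx.toFun f → ∀ X : Fin 2, u (eta (ordK f)) = eta (ordK f') := by
    intro u f f' hf hf' hκ X
    obtain ⟨n, hn⟩ := exists_eq_c_of_fixed c x ρ hM₂ hx_inj hsx' hmv f.2 hf
    obtain ⟨m, hm⟩ := exists_eq_c_of_fixed c x ρ hM₂ hx_inj hsx' hmv f'.2 hf'
    have ef : f = ⟨c n, Or.inl ⟨n, rfl⟩⟩ := Subtype.ext hn
    have ef' : f' = ⟨c m, Or.inl ⟨m, rfl⟩⟩ := Subtype.ext hm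
    subst ef ef'
    rw [hκxc, hκxc] at hκ
    exact ord_ray u n m hκ X
  -- the torsion criterion: `κx(2ⁿ)` restricts to torsion, `κx(xᵢ)` does not
  have law_tors : ∀ f : N.infκxPair.carrier, ((f : K) ∈ Set.range c ↔ IsOfFinOrder (r (κx.toFun f))) := by
    intro f
    rcases (hM₂ _).1 f.2 with ⟨n, hn⟩ | ⟨i, hi⟩
    · have ef : f = ⟨c n, Or.inl ⟨n, rfl⟩⟩ := Subtype.ext hn
      rw [ef, hκxc]
      exact ⟨fun _ => htor_z n, fun _ => ⟨n, rfl⟩⟩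
    · have ef : f = ⟨x i, Or.inr ⟨i, rfl⟩⟩ := Subtype.ext hi
      rw [ef, hκxx]
      refine ⟨fun hm => ?_, fun h => absurd h (htor_v i)⟩
      obtain ⟨m, hm⟩ := hm
      exact absurd hm (hcx m i)
  refine ⟨N, H, instH, actN, twH, κ, κx, Fin 2, fun _ => ordK, R, ⟨Equiv.swap 0 1, Equiv.swap 1 2, hS3⟩,
    ?_, ?_, ?_, ?_, ?_, law_ordx, ?_, ?_, ?_, ?_, ?_, ?_, ?_, ?_⟩
  · -- F-2571: the ray is fixed, so `𝕄^⊛_κ = (𝕄^⊛_∞κ)^{π₁^rat}`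
    refine ⟨Set.ext fun f => ⟨fun hf => ⟨hf, fun g => ?_⟩, fun hf => hf.1⟩⟩
    obtain ⟨n, rfl⟩ := hf
    exact hsc' g n
  · -- (a): the ∞κ-pair has only the identity automorphism
    intro e
    refine ⟨1, fun y => ?_⟩
    rw [one_smul, iso_apply_eq_self (fun g _ hf => N.smul_mem_minfκ g hf) c x₀ ρ₀ hM₁ hc_inj (fun i => i.elim0)
      (fun _ i => i.elim0) (fun h => N.zero_notMem (N.minfκ_subset h)) hc0 hcc hsc' (fun _ i => i.elim0)
      (fun i => i.elim0) (fun i => i.elim0) e y]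
  · -- (a×): the ∞κ×-pair has only the identity automorphism (self-normalising stabilisers)
    intro e
    refine ⟨1, fun y => ?_⟩
    rw [one_smul, iso_apply_eq_self (fun g _ hf => N.smul_mem_minfκx g hf) c x ρ hM₂ hc_inj hx_inj hcx
      N.zero_notMem hc0 hcc hsc' hsx' hmv hmove e y]
  · -- (b′), phrased on `𝕄^⊛_κ`
    exact fun u f f' _ _ hκ X => law_ord u f f' hκ X
  · -- (b′), phrased on the fixed ∞κ-coric functions
    exact fun u f f' _ _ hκ X => law_ord u f f' hκ X
  · -- pole shape on `𝕄^⊛_κ`: orders are nonnegative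
    intro f' _ x₁ x₂ _ h
    exact (not_lt.2 (ord_nonneg f')) h.1
  · -- a κ-coric function with two zeroes: `2`
    exact ⟨c 1, ⟨1, rfl⟩, 0, 1, h01, two_zeros, two_zeros⟩
  · -- a fixed ∞κ-coric function with two zeroes: `2`
    exact ⟨c 1, ⟨1, rfl⟩, fun g => hsc' g 1, 0, 1, h01, two_zeros, two_zeros⟩
  · -- pole shape on the fixed ∞κ×-coric functions
    intro f' _ _ x₁ x₂ _ h
    exact (not_lt.2 (ord_nonneg f')) h.1
  · -- a fixed ∞κ×-coric function with two zeroes: `2`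
    exact ⟨c 1, Or.inl ⟨1, rfl⟩, fun g => hsc' g 1, 0, 1, h01, two_zeros, two_zeros⟩
  · -- the transposition `(0 1) ∈ π₁^{rat/κ-sol}` moves `x₀`
    refine ⟨Equiv.swap 0 1, Subgroup.mem_inf.2 ⟨?_, Subgroup.mem_comap.2 (Subgroup.mem_top _)⟩, x 0,
      Or.inr ⟨0, rfl⟩, ?_⟩
    · rintro f ⟨n, rfl⟩
      exact hsc' _ n
    · intro h
      have h' : x (ρ (Equiv.swap 0 1) 0) = x 0 := (hsx' _ 0).symm.trans h
      exact hsw (hx_inj h')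
  · -- torsion criterion, "some"
    intro f
    refine (law_tors f).trans ⟨fun h => ⟨PUnit.unit, h⟩, fun hex => ?_⟩
    obtain ⟨i, hi⟩ := hex
    exact hi
  · -- torsion criterion, "every"
    intro f
    exact (law_tors f).trans ⟨fun h _ => h, fun h => h PUnit.unit⟩

/-- **The v0.1 N-block, in the certificate's order.**  The ELEVEN N-side binders of
`Summit.ABC.IUTFork.Conditional.layer5_held_ex51v` (`Layer5OfSEx51.lean`, p431142) — `hF_2571`, `h_Ex51v_nat`,
`h_Ex51v_natx`, `h_Ex51v_ord`, `h_Ex51v_ordx`, `h_Ex51v_pole`, `h_Ex51v_zero`, `h_Ex51v_polex`, `h_Ex51v_zerox`,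
`h_Ex51v_moves` — are JOINTLY INHABITED at a datum with non-commutative `π₁^rat(†𝒟^⊛)`.  DEGENERATE TOY; not a
discharge. ([IUTchI] Ex 5.1 (v) pp.127–128) [claim: Mochizuki2012, status: disputed] -/
theorem exists_ex51v_binders_v1 :
    ∃ (N : NFBridgeRecon.{0}) (H : Type) (_ : CommGroup H) (_ : MulAction N.piRat H)
      (_ : MulAction (MulAut (completion (GrpCat.of (Multiplicative ℤ)))) H)
      (κ : N.infκPair.KummerRealization H) (κx : N.infκxPair.KummerRealization H)
      (X : Type) (ord : X → N.Krat → ℤ),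
      (∃ a b : N.piRat, a * b ≠ b * a) ∧
      N.MκIsInvariants ∧
      (∀ e : CoricPair.Iso N.infκPair N.infκPair,
        ∃ u : MulAut (completion (GrpCat.of (Multiplicative ℤ))),
          ∀ y : N.infκPair.carrier, κ.toFun (e.toEquiv y) = u • κ.toFun y) ∧
      (∀ e : CoricPair.Iso N.infκxPair N.infκxPair,
        ∃ u : MulAut (completion (GrpCat.of (Multiplicative ℤ))),
          ∀ y : N.infκxPair.carrier, κx.toFun (e.toEquiv y) = u • κx.toFun y) ∧
      (∀ (u : MulAut (completion (GrpCat.of (Multiplicative ℤ)))) (f f' : N.infκPair.carrier),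
        (f : N.Krat) ∈ N.Mκ → (f' : N.Krat) ∈ N.Mκ → κ.toFun f' = u • κ.toFun f →
        ∀ x : X, u (eta (ord x f)) = eta (ord x f')) ∧
      (∀ (u : MulAut (completion (GrpCat.of (Multiplicative ℤ)))) (f f' : N.infκxPair.carrier),
        (∀ g : N.piRat, g • (f : N.Krat) = f) → (∀ g : N.piRat, g • (f' : N.Krat) = f') →
        κx.toFun f' = u • κx.toFun f → ∀ x : X, u (eta (ord x f)) = eta (ord x f')) ∧
      (∀ f' ∈ N.Mκ, ∀ x₁ x₂ : X, x₁ ≠ x₂ → ¬ (ord x₁ f' < 0 ∧ ord x₂ f' < 0)) ∧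
      (∃ f ∈ N.Mκ, ∃ x₁ x₂ : X, x₁ ≠ x₂ ∧ 0 < ord x₁ f ∧ 0 < ord x₂ f) ∧
      (∀ f' ∈ N.Minfκx, (∀ g : N.piRat, g • f' = f') →
        ∀ x₁ x₂ : X, x₁ ≠ x₂ → ¬ (ord x₁ f' < 0 ∧ ord x₂ f' < 0)) ∧
      (∃ f ∈ N.Minfκx, (∀ g : N.piRat, g • f = f) ∧ ∃ x₁ x₂ : X, x₁ ≠ x₂ ∧ 0 < ord x₁ f ∧ 0 < ord x₂ f) ∧
      (∃ g ∈ N.ratKsolKer, ∃ f ∈ N.Minfκx, g • f ≠ f) := by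
  obtain ⟨N, H, i₁, i₂, i₃, κ, κx, X, ord, -, hne, hF, hnat, hnatx, hord, -, hordx, hpole, hzero, -, hpolex,
    hzerox, hmoves, -, -⟩ := exists_laws_nonabelian
  exact ⟨N, H, i₁, i₂, i₃, κ, κx, X, ord, hne, hF, hnat, hnatx, hord, hordx, hpole, hzero, hpolex, hzerox, hmoves⟩

/-- **The v0.2 N-block, in the certificate's order.**  The NINE N-side binders of
`Summit.ABC.IUTFork.Conditional.layer5_held_ex51v_v2` (`Layer5OfSV02.lean`, p433973) — `h_Ex51v_nat`,
`h_Ex51v_natx`, `h_Ex51v_ord` (on the fixed ∞κ-coric functions), `h_Ex51v_ordx`, `h_Ex51v_polex`, `h_Ex51v_zero`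
(a fixed ∞κ-coric function with two zeroes), `h_Ex51v_moves`, `h_Ex51v_tors_some`, `h_Ex51v_tors_every` — are
JOINTLY INHABITED, together with the restriction data `R`, at a datum with non-commutative `π₁^rat(†𝒟^⊛)`.
DEGENERATE TOY; not a discharge. ([IUTchI] Ex 5.1 (v) pp.127–129) [claim: Mochizuki2012, status: disputed] -/
theorem exists_ex51v_binders_v2 :
    ∃ (N : NFBridgeRecon.{0}) (H : Type) (_ : CommGroup H) (_ : MulAction N.piRat H)
      (_ : MulAction (MulAut (completion (GrpCat.of (Multiplicative ℤ)))) H)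
      (κ : N.infκPair.KummerRealization H) (κx : N.infκxPair.KummerRealization H)
      (X : Type) (ord : X → N.Krat → ℤ) (R : CriticalRestrictionData N.piRat H),
      (∃ a b : N.piRat, a * b ≠ b * a) ∧
      (∀ e : CoricPair.Iso N.infκPair N.infκPair,
        ∃ u : MulAut (completion (GrpCat.of (Multiplicative ℤ))),
          ∀ y : N.infκPair.carrier, κ.toFun (e.toEquiv y) = u • κ.toFun y) ∧
      (∀ e : CoricPair.Iso N.infκxPair N.infκxPair,
        ∃ u : MulAut (completion (GrpCat.of (Multiplicative ℤ))),
          ∀ y : N.infκxPair.carrier, κx.toFun (e.toEquiv y) = u • κx.toFun y) ∧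
      (∀ (u : MulAut (completion (GrpCat.of (Multiplicative ℤ)))) (f f' : N.infκPair.carrier),
        (∀ g : N.piRat, g • (f : N.Krat) = f) → (∀ g : N.piRat, g • (f' : N.Krat) = f') →
        κ.toFun f' = u • κ.toFun f → ∀ x : X, u (eta (ord x f)) = eta (ord x f')) ∧
      (∀ (u : MulAut (completion (GrpCat.of (Multiplicative ℤ)))) (f f' : N.infκxPair.carrier),
        (∀ g : N.piRat, g • (f : N.Krat) = f) → (∀ g : N.piRat, g • (f' : N.Krat) = f') →
        κx.toFun f' = u • κx.toFun f → ∀ x : X, u (eta (ord x f)) = eta (ord x f')) ∧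
      (∀ f' ∈ N.Minfκx, (∀ g : N.piRat, g • f' = f') →
        ∀ x₁ x₂ : X, x₁ ≠ x₂ → ¬ (ord x₁ f' < 0 ∧ ord x₂ f' < 0)) ∧
      (∃ f ∈ N.Minfκ, (∀ g : N.piRat, g • f = f) ∧ ∃ x₁ x₂ : X, x₁ ≠ x₂ ∧ 0 < ord x₁ f ∧ 0 < ord x₂ f) ∧
      (∃ g ∈ N.ratKsolKer, ∃ f ∈ N.Minfκx, g • f ≠ f) ∧
      (∀ f : N.infκxPair.carrier, (f : N.Krat) ∈ N.Minfκ ↔ ∃ i : R.Idx, IsOfFinOrder (R.res i (κx.toFun f))) ∧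
      (∀ f : N.infκxPair.carrier, (f : N.Krat) ∈ N.Minfκ ↔ ∀ i : R.Idx, IsOfFinOrder (R.res i (κx.toFun f))) := by
  obtain ⟨N, H, i₁, i₂, i₃, κ, κx, X, ord, R, hne, -, hnat, hnatx, -, hord', hordx, -, -, hzero', hpolex, -,
    hmoves, hsome, hevery⟩ := exists_laws_nonabelian
  exact ⟨N, H, i₁, i₂, i₃, κ, κx, X, ord, R, hne, hnat, hnatx, hord', hordx, hpolex, hzero', hmoves, hsome, hevery⟩

end CoricLawsToy

end NFBridgeRecon

end Literature.IUT.HodgeTheaters
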